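import Summits.ResolutionOfSingularities.ResolutionOfSingularities.Theorems.WeightedInvariantHypersurfaceLocalGameEFTCurveMoveDrop
import Summits.ResolutionOfSingularities.ResolutionOfSingularities.Theorems.WeightedInvariantHypersurfaceLocalGameEFTDimTwoTangent
import Summits.ResolutionOfSingularities.ResolutionOfSingularities.Theorems.WeightedInvariantHypersurfaceLocalGameEFTDimTwoDrops
import HarnessLib

/-!
# The e.f.t. local weighted game (H2a′) in dimension two, for the order function `iotaOrd`

Topic: `Summits/ResolutionOfSingularities/ResolutionOfSingularities/Theorems`. Helper for the door item
`HypersurfaceCentreConstruction` (statement `stmt-ResolutionOfSingularities-19897`, route `WeightedInvariant`);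
kernel K7 (ASSEMBLY), part 3 of 3, of the dim-2 design memo `L/res-type-098-w43/EFT-DIM2-DESIGN.md` v2
(ORDER (o13) of `res-L1-w43-plan-1`), for THE named rank `ι = iotaOrd` (res-type-073, p502169).

[OURS · L1 W4.3] Replaces the role of NO printed item; NOT a statement of the manuscript
[claim: Hironaka2017, status: under-review]. AI work, weaker than expert review.

## Statement proved

**`localGameEFT_clause_iotaOrd_of_ringKrullDim_eq_two`.** Let `S` be a regular local ring of Krull dimension `2`,
essentially of finite type over a field `k₀` (ANY field: `CharP`/`PerfectField` are idle), and `0 ≠ f ∈ 𝔪²`. Then the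
`∃ n u w`-clause of `LocalWeightedDropEFT p` holds at `(S, f)` for `ι = iotaOrd`: there is an honest weighted move
(a regular system of parameters `u` of `S` with weights) which is admissible and after which, at every singular
point of the transform on the exceptional divisor of the full cobordant blow-up, the order has dropped.
`localWeightedDropEFT_clause_iotaOrd_of_ringKrullDim_eq_two` carries the def's binders for an assembly by cases
on `dim S` (the dim-1 rung is p499453, every `ι`).

## The move, AT THE MOVE LEVEL (`exists_sq_dvd_or_terminal` / `exists_sq_dvd_or_pointMove_lt`; what (o24-G) cites)

With `ν = ord_𝔪 f ≥ 2` (`= iotaOrd S f`): EITHER `π² ∣ f` for a regular parameter `π ∈ 𝔪 ∖ 𝔪²` — then the CURVE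
MOVE through `π` drops (K2, `localGameEFT_clause_iotaOrd_of_sq_dvd'`, p505980) — OR there are a regular system of
parameters `(x, y_T)` and a level `b_T ≥ 1` such that the POINT MOVE `u = (x, y_T)`, `w = (1, b_T)` drops `iotaOrd`
below `ν` at every singular successor point. The terminal `(x, y_T, b_T)` is produced by the loop of the memo (§2):
tangent cone not a rational `ν`-fold line ⇒ `b_T = 1` (part 1, `tangent_win_or_prepared`); else prepared at level
`1`, and from a prepared level `b` (`f ≡ c·y^ν mod 𝒥_b(bν+1)`): level `b+1` not reached ⇒ case C, `b_T = b`
(`pointMove_iotaOrd_lt_of_prepared_of_not_mem`); reached but not steepenable ⇒ case D, `b_T = b + 1`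
(`pointMove_iotaOrd_lt_of_not_steepenable`); steepenable ⇒ prepared at level `b + 1` in `(x, y - λ̃ x^{b+1})`.
An endless run of steepenings makes `f = unit · π^ν` by res-type-078's K6 (EXCELLENCE of `S`, through
res-type-092's `LocalGameEFTNewton.exists_associated_pow_of_forall_exists_next`), which is the first alternative.
`exists_sq_dvd_or_terminal` returns the terminal `(x, y_T, b_T)` WITH ITS CERTIFICATE (case B / C / D data), as
asked by res-L1-w43-plan-1 ORDER (o24-G) 2026-08-27T08:16:45Z for the (o24) canonicity kernels (078's C5).

## References

* J. Włodarczyk, *Functorial resolution by torus actions*, arXiv:2203.03090, Def. 2.3.5, §2.3.9, §3.3. [Wlodarczyk2022]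
* H. Matsumura, *Commutative Ring Theory*, Thm. 14.2, Thm. 16.2, §32. [Matsumura1987]
-/

noncomputable section

open IsLocalRing Literature.AlgebraicGeometry.Resolution
open Summit.ResolutionOfSingularities.ResolutionOfSingularities.Cruxes.HypersurfaceCentreConstruction.LocalEngine
  (iotaOrd)

set_option linter.dupNamespace false -- mandated namespace of this single-conjunct summit

namespace Summit.ResolutionOfSingularities.ResolutionOfSingularities.Theorems

namespace LocalGameEFTDimTwo

variable {S : Type} [CommRing S]

/-! ### The terminal datum of the steepening loop (certificate) -/

/-- **The dim-2 rung: the TERMINAL DATUM with its certificate.** `S` regular local of Krull dimension `2`, essentially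
of finite type over a field `k₀`, `0 ≠ f ∈ 𝔪²`, `ν = ord_𝔪 f` (`f ∈ 𝔪^ν ∖ 𝔪^{ν+1}`, `iotaOrd S f = ν`, `ν ≥ 2`). EITHER
`π² ∣ f` for some `π ∈ 𝔪 ∖ 𝔪²` (case A / E, incl. an endless run of steepenings, by EXCELLENCE: K6), OR there are a
regular system of parameters `(x, y_T)` and a level `b_T ≥ 1` carrying one of the three terminal certificates of
the memo: (B) `b_T = 1` and `f` is prepared at level `1` in NO regular system of parameters (tangent cone not a
rational `ν`-fold line); (C) prepared at level `b_T` in `(x, y_T)` and `f ∉ 𝒥_{b_T+1}((b_T+1)ν)`; (D) `b_T ≥ 2`,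
`f ∈ 𝒥_{b_T}(b_T ν)` and no steepening `y_T ↦ y_T - λ̃ x^{b_T}` prepares `f` at level `b_T`. (What (o24-G)/C5
consume; each certificate yields the drop of the point move `(x, y_T), (1, b_T)`: `exists_sq_dvd_or_pointMove_lt`.)
[OURS · L1 W4.3 · K7] -/
theorem exists_sq_dvd_or_terminal (S : Type) [CommRing S] [IsRegularLocalRing S]
    (k₀ : Type) [Field k₀] [Algebra k₀ S] [Algebra.EssFiniteType k₀ S]
    (hdim : ringKrullDim S = 2) (f : S) (hf0 : f ≠ 0) (hf2 : f ∈ (maximalIdeal S) ^ 2) :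
    ∃ ν : ℕ, 2 ≤ ν ∧ f ∈ maximalIdeal S ^ ν ∧ f ∉ maximalIdeal S ^ (ν + 1) ∧ iotaOrd S f = ν ∧
      ((∃ π : S, π ∈ maximalIdeal S ∧ π ∉ maximalIdeal S ^ 2 ∧ π ^ 2 ∣ f) ∨
        ∃ (x y : S) (b : ℕ), Ideal.span {x, y} = maximalIdeal S ∧ 1 ≤ b ∧
          ((b = 1 ∧ ¬ ∃ x' y' c : S, Ideal.span {x', y'} = maximalIdeal S ∧ IsUnit c ∧
              f - c * y' ^ ν ∈ weightedMonomialIdeal ![x', y'] ![1, 1] (1 * ν + 1)) ∨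
           ((∃ c : S, IsUnit c ∧ f - c * y ^ ν ∈ weightedMonomialIdeal ![x, y] ![1, b] (b * ν + 1)) ∧
              f ∉ weightedMonomialIdeal ![x, y] ![1, b + 1] ((b + 1) * ν)) ∨
           (2 ≤ b ∧ f ∈ weightedMonomialIdeal ![x, y] ![1, b] (b * ν) ∧
              ¬ ∃ c lam : S, IsUnit c ∧
                f - c * (y - lam * x ^ b) ^ ν ∈ weightedMonomialIdeal ![x, y] ![1, b] (b * ν + 1)))) := by
  classical
  haveI := isDomain_of_isRegularLocalRing S
  obtain ⟨ν, hν2, hfν, hfν', hιν⟩ := exists_order hf0 hf2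
  refine ⟨ν, hν2, hfν, hfν', hιν, ?_⟩
  have hν1 : 1 ≤ ν := by omega
  have hdimS : ringKrullDim S = (2 : ℕ) := ringKrullDim_eq_two_nat hdim
  by_contra H
  obtain ⟨HA, HT⟩ := not_or.mp H
  -- not prepared at level one in any coordinates: certificate (B) in any regular system of parameters
  by_cases hprep1 : ∃ x' y' c : S, Ideal.span {x', y'} = maximalIdeal S ∧ IsUnit c ∧
      f - c * y' ^ ν ∈ weightedMonomialIdeal ![x', y'] ![1, 1] (1 * ν + 1)
  swap
  · obtain ⟨x₀, y₀, hxy₀⟩ := exists_span_pair_eq_maximalIdeal S hdim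
    exact HT ⟨x₀, y₀, 1, hxy₀, le_rfl, Or.inl ⟨rfl, hprep1⟩⟩
  obtain ⟨x, y₁, c₁, hxy, hc₁, hprep₁⟩ := hprep1
  -- the loop: prepared at level `b` in `(x, y)` ⇒ prepared at level `b + 1` ((C) and (D) are excluded by `HT`)
  have hx : x ∈ maximalIdeal S := hxy ▸ Ideal.subset_span (by simp)
  set P : ℕ → S → Prop := fun b y => 1 ≤ b ∧ Ideal.span {x, y} = maximalIdeal S ∧
    ∃ c : S, IsUnit c ∧ f - c * y ^ ν ∈ weightedMonomialIdeal ![x, y] ![1, b] (b * ν + 1) with hPdef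
  have hP : ∀ b y, P b y → y ∈ maximalIdeal S ∧ y ∉ maximalIdeal S ^ 2 ∧ f ∈ Ideal.span {y ^ ν, x ^ b} := by
    rintro b y ⟨-, hxy', c, -, hprep⟩
    exact ⟨hxy' ▸ Ideal.subset_span (by simp), (LocalGameEFTSteepening.not_mem_sq_of_span_pair_eq hdimS hxy').2,
      LocalGameEFTNewton.mem_span_pair_of_prepared hprep⟩
  have hnext : ∀ b y, P b y → ∃ b' y', b < b' ∧ P b' y' ∧ y' - y ∈ Ideal.span {x ^ b} := by
    rintro b y ⟨hb, hxy', c, hc, hprep⟩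
    rcases LocalGameEFTNewton.caseC_or_levelUp hc hprep with ⟨-, hc', hnot⟩ | hup
    · exact absurd ⟨x, y, b, hxy', hb, Or.inr (Or.inl ⟨hc', hnot⟩)⟩ HT
    by_cases hst : ∃ c' lam : S, IsUnit c' ∧
        f - c' * (y - lam * x ^ (b + 1)) ^ ν ∈ weightedMonomialIdeal ![x, y] ![1, b + 1] ((b + 1) * ν + 1)
    swap
    · exact absurd ⟨x, y, b + 1, hxy', Nat.le_succ_of_le hb, Or.inr (Or.inr ⟨Nat.succ_le_succ hb, hup, hst⟩)⟩ HT
    obtain ⟨c', lam, hc', hprep'⟩ := hst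
    refine ⟨b + 1, y - lam * x ^ (b + 1), Nat.lt_succ_self b, ⟨Nat.le_succ_of_le hb, ?_, c', hc', ?_⟩, ?_⟩
    · rw [LocalGameEFTSteepening.span_pair_steepen_eq x y lam (Nat.succ_le_succ (Nat.zero_le b)), hxy']
    · rwa [LocalGameEFTSteepening.weightedMonomialIdeal_steepen_eq]
    · exact Ideal.span_singleton_le_span_singleton.mpr (pow_dvd_pow x (Nat.le_succ b))
        (LocalGameEFTSteepening.steepen_sub_mem x y lam _)
  have h₀ : P 1 y₁ := ⟨le_rfl, hxy, c₁, hc₁, hprep₁⟩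
  -- excellence: an endless run of steepenings forces `f = unit · π^ν`
  have hk : IsExcellentRing k₀ := Stacks07QW_field_holds k₀ k₀ inferInstance
  have hS : IsExcellentRing S := hk.of_essFiniteType ‹_›
  obtain ⟨π, hπ, hπ2, hass⟩ :=
    LocalGameEFTNewton.exists_associated_pow_of_forall_exists_next hS hx hν1 hfν' P hP hnext h₀
  exact HA ⟨π, hπ, hπ2, (pow_dvd_pow π hν2).trans hass.symm.dvd⟩

/-! ### The winning move, at the move level -/

/-- **The dim-2 rung at the MOVE level.** `S` regular local of Krull dimension `2`, essentially of finite type over a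
field `k₀`, `0 ≠ f ∈ 𝔪²`, `ν = iotaOrd S f` (`≥ 2`). EITHER `π² ∣ f` for some `π ∈ 𝔪 ∖ 𝔪²` (the curve move through
`π` drops, K2), OR for some regular system of parameters `(x, y)` and `b ≥ 1` the point move `u = (x, y)`,
`w = (1, b)` drops `iotaOrd` below `ν` at every prime `𝔫 ∋ t⁻¹` of `B = S[t⁻¹, 𝒥ₙtⁿ]` over `𝔪B`, off the vertex,
for every saturated transform singular at `𝔫` (from the certificates of `exists_sq_dvd_or_terminal`: (B)
`tangent_win_or_prepared`, (C) `pointMove_iotaOrd_lt_of_prepared_of_not_mem`, (D)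
`pointMove_iotaOrd_lt_of_not_steepenable`). [OURS · L1 W4.3 · K7] -/
theorem exists_sq_dvd_or_pointMove_lt (S : Type) [CommRing S] [IsRegularLocalRing S]
    (k₀ : Type) [Field k₀] [Algebra k₀ S] [Algebra.EssFiniteType k₀ S]
    (hdim : ringKrullDim S = 2) (f : S) (hf0 : f ≠ 0) (hf2 : f ∈ (maximalIdeal S) ^ 2) :
    ∃ ν : ℕ, 2 ≤ ν ∧ iotaOrd S f = ν ∧
      ((∃ π : S, π ∈ maximalIdeal S ∧ π ∉ maximalIdeal S ^ 2 ∧ π ^ 2 ∣ f) ∨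
        ∃ (x y : S) (b : ℕ), Ideal.span {x, y} = maximalIdeal S ∧ 1 ≤ b ∧
          ∀ (𝔫 : Ideal (extReesAlgebra (weightedMonomialIdeal ![x, y] ![1, b]))) [𝔫.IsPrime],
            extReesAlgebra.tInv (weightedMonomialIdeal ![x, y] ![1, b]) ∈ 𝔫 →
            (maximalIdeal S).map (algebraMap S (extReesAlgebra (weightedMonomialIdeal ![x, y] ![1, b]))) ≤ 𝔫 →
            ¬ (extReesAlgebra.vertexIdeal (weightedMonomialIdeal ![x, y] ![1, b]) ≤ 𝔫) →
            ∀ (a' : ℕ) (g : extReesAlgebra (weightedMonomialIdeal ![x, y] ![1, b])),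
              algebraMap S (extReesAlgebra (weightedMonomialIdeal ![x, y] ![1, b])) f =
                extReesAlgebra.tInv (weightedMonomialIdeal ![x, y] ![1, b]) ^ a' * g →
              ¬ (extReesAlgebra.tInv (weightedMonomialIdeal ![x, y] ![1, b]) ∣ g) →
              algebraMap (extReesAlgebra (weightedMonomialIdeal ![x, y] ![1, b])) (Localization.AtPrime 𝔫) g ∈
                (maximalIdeal (Localization.AtPrime 𝔫)) ^ 2 →
              iotaOrd (Localization.AtPrime 𝔫)
                (algebraMap (extReesAlgebra (weightedMonomialIdeal ![x, y] ![1, b])) (Localization.AtPrime 𝔫) g) <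
                ν) := by
  have hd : (maximalIdeal S).spanFinrank = 2 := spanFinrank_eq_two hdim
  obtain ⟨ν, hν2, hfν, hfν', hιν, hA | ⟨x, y, b, hxy, hb, hB | ⟨⟨c, hc, hprep⟩, hnot⟩ | ⟨hb2, hfJ, hst⟩⟩⟩ :=
    exists_sq_dvd_or_terminal S k₀ hdim f hf0 hf2
  · exact ⟨ν, hν2, hιν, Or.inl hA⟩
  · obtain ⟨rfl, hnp⟩ := hB
    exact ⟨ν, hν2, hιν, Or.inr ⟨x, y, 1, hxy, le_rfl,
      (tangent_win_or_prepared hd hxy (by omega) hfν hfν').resolve_right hnp⟩⟩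
  · exact ⟨ν, hν2, hιν, Or.inr ⟨x, y, b, hxy, hb,
      pointMove_iotaOrd_lt_of_prepared_of_not_mem hd hxy hb hc hprep hnot⟩⟩
  · exact ⟨ν, hν2, hιν, Or.inr ⟨x, y, b, hxy, hb,
      pointMove_iotaOrd_lt_of_not_steepenable hd hxy (by omega) hfν hfν' hb2 hfJ hst⟩⟩

/-! ### The `∃`-clause of `LocalWeightedDropEFT` in dimension two -/

/-- **The e.f.t. local weighted game in dimension two, for `ι = iotaOrd`.** Let `S` be a regular local ring of Krull
dimension `2`, essentially of finite type over a field `k₀`, and `0 ≠ f ∈ 𝔪_S²`. Then some honest weighted move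
`(u, w)` — a regular system of parameters `u` of `S` (`(u) = 𝔪_S`, `spanFinrank 𝔪_S = n`) with weights `w ≠ 0` —
satisfies the `∀`-clause of the candidate H2a′ `LocalWeightedDropEFT` (door `HypersurfaceCentreConstruction`, line
`local-engine`) for `ι = iotaOrd`: it is admissible (`f ∈ 𝔪_{S_P}²` for every prime `P ⊇ (u_i : w_i > 0)`), and for
every prime `𝔫` of the full cobordant blow-up algebra `B = S[t⁻¹, 𝒥ₙtⁿ]` containing `t⁻¹`, lying over `𝔪_S` and
not containing the vertex ideal, and every `t⁻¹`-saturated `g` with `f = t⁻ᵃ g` and `g ∈ 𝔪_{B_𝔫}²`,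
`iotaOrd B_𝔫 g < iotaOrd S f`. The move is the curve move through a repeated regular factor (case A) or a point
move `(x, y), (1, b)` (cases B/C/D after finitely many steepenings, by excellence). [OURS · L1 W4.3 · K7] -/
theorem localGameEFT_clause_iotaOrd_of_ringKrullDim_eq_two (S : Type) [CommRing S] [IsRegularLocalRing S]
    (k₀ : Type) [Field k₀] [Algebra k₀ S] [Algebra.EssFiniteType k₀ S]
    (hdim : ringKrullDim S = 2) (f : S) (hf0 : f ≠ 0) (hf2 : f ∈ (maximalIdeal S) ^ 2) :
    ∃ (n : ℕ) (u : Fin n → S) (w : Fin n → ℕ),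
      Ideal.span (Set.range u) = maximalIdeal S ∧ (maximalIdeal S).spanFinrank = n ∧ (∃ i, 0 < w i) ∧
      (∀ (P : Ideal S) [P.IsPrime], (∀ i, 0 < w i → u i ∈ P) →
        algebraMap S (Localization.AtPrime P) f ∈ (maximalIdeal (Localization.AtPrime P)) ^ 2) ∧
      ∀ (𝔫 : Ideal (extReesAlgebra (weightedMonomialIdeal u w))) [𝔫.IsPrime],
        extReesAlgebra.tInv (weightedMonomialIdeal u w) ∈ 𝔫 →
        (maximalIdeal S).map (algebraMap S (extReesAlgebra (weightedMonomialIdeal u w))) ≤ 𝔫 →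
        ¬ (extReesAlgebra.vertexIdeal (weightedMonomialIdeal u w) ≤ 𝔫) →
        ∀ (a : ℕ) (g : extReesAlgebra (weightedMonomialIdeal u w)),
          algebraMap S (extReesAlgebra (weightedMonomialIdeal u w)) f =
            extReesAlgebra.tInv (weightedMonomialIdeal u w) ^ a * g →
          ¬ (extReesAlgebra.tInv (weightedMonomialIdeal u w) ∣ g) →
          algebraMap (extReesAlgebra (weightedMonomialIdeal u w)) (Localization.AtPrime 𝔫) g ∈
            (maximalIdeal (Localization.AtPrime 𝔫)) ^ 2 →
          iotaOrd (Localization.AtPrime 𝔫)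
              (algebraMap (extReesAlgebra (weightedMonomialIdeal u w)) (Localization.AtPrime 𝔫) g) <
            iotaOrd S f := by
  obtain ⟨ν, -, hιν, hA | ⟨x, y, b, hxy, hb, hdrop⟩⟩ := exists_sq_dvd_or_pointMove_lt S k₀ hdim f hf0 hf2
  · obtain ⟨π, hπ, hπ2, hdiv⟩ := hA
    exact localGameEFT_clause_iotaOrd_of_sq_dvd' S hπ hπ2 f hf0 hdiv
  · exact clause_of_pointMove_lt S (spanFinrank_eq_two hdim) hxy hb f hf2 hιν hdrop

/-- **The clause of `LocalWeightedDropEFT p` restricted to `ringKrullDim S = 2`, for `ι = iotaOrd`** — with the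
def's binders (`k₀` perfect of characteristic `p`, idle here beyond `Field k₀`): the statement an assembly of
`LocalWeightedDropEFT p` for `ι = iotaOrd` by cases on `dim S` consumes with `exact`. [OURS · L1 W4.3 · K7] -/
theorem localWeightedDropEFT_clause_iotaOrd_of_ringKrullDim_eq_two (p : ℕ)
    (k₀ : Type) [Field k₀] [CharP k₀ p] [PerfectField k₀]
    (S : Type) [CommRing S] [Algebra k₀ S] [Algebra.EssFiniteType k₀ S] [IsRegularLocalRing S]
    (hdim : ringKrullDim S = 2)
    (f : S) (hf0 : f ≠ 0) (hf2 : f ∈ (maximalIdeal S) ^ 2) :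
    ∃ (n : ℕ) (u : Fin n → S) (w : Fin n → ℕ),
      Ideal.span (Set.range u) = maximalIdeal S ∧ (maximalIdeal S).spanFinrank = n ∧ (∃ i, 0 < w i) ∧
      (∀ (P : Ideal S) [P.IsPrime], (∀ i, 0 < w i → u i ∈ P) →
        algebraMap S (Localization.AtPrime P) f ∈ (maximalIdeal (Localization.AtPrime P)) ^ 2) ∧
      ∀ (𝔫 : Ideal (extReesAlgebra (weightedMonomialIdeal u w))) [𝔫.IsPrime],
        extReesAlgebra.tInv (weightedMonomialIdeal u w) ∈ 𝔫 →
        (maximalIdeal S).map (algebraMap S (extReesAlgebra (weightedMonomialIdeal u w))) ≤ 𝔫 →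
        ¬ (extReesAlgebra.vertexIdeal (weightedMonomialIdeal u w) ≤ 𝔫) →
        ∀ (a : ℕ) (g : extReesAlgebra (weightedMonomialIdeal u w)),
          algebraMap S (extReesAlgebra (weightedMonomialIdeal u w)) f =
            extReesAlgebra.tInv (weightedMonomialIdeal u w) ^ a * g →
          ¬ (extReesAlgebra.tInv (weightedMonomialIdeal u w) ∣ g) →
          algebraMap (extReesAlgebra (weightedMonomialIdeal u w)) (Localization.AtPrime 𝔫) g ∈
            (maximalIdeal (Localization.AtPrime 𝔫)) ^ 2 →
          iotaOrd (Localization.AtPrime 𝔫)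
              (algebraMap (extReesAlgebra (weightedMonomialIdeal u w)) (Localization.AtPrime 𝔫) g) <
            iotaOrd S f :=
  localGameEFT_clause_iotaOrd_of_ringKrullDim_eq_two S k₀ hdim f hf0 hf2

/-! ### Appendix (rev 2): the sharper first alternative — MONOMIAL TYPE, not only a repeated factor -/

/-- **The dim-2 rung: terminal datum with certificate, SHARP form.** As `exists_sq_dvd_or_terminal`, but the first
alternative is recorded in the sharp form the loop actually produces — `f` is a UNIT times `π^ν` for a regular
parameter `π ∈ 𝔪 ∖ 𝔪²` (MONOMIAL TYPE, `ν = ord_𝔪 f`) — instead of its consequence `π² ∣ f`: a position that is NOT of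
monomial type (e.g. `f = π² x`) therefore ALWAYS carries a terminal point-move certificate (B)/(C)/(D). This is the
case split of ORDER (o24-G) (res-L1-w43-plan-1 2026-08-27T08:16:45Z: «refined to monomial type, else fall to case B»).
[OURS · L1 W4.3 · K7] -/
theorem exists_associated_pow_or_terminal (S : Type) [CommRing S] [IsRegularLocalRing S]
    (k₀ : Type) [Field k₀] [Algebra k₀ S] [Algebra.EssFiniteType k₀ S]
    (hdim : ringKrullDim S = 2) (f : S) (hf0 : f ≠ 0) (hf2 : f ∈ (maximalIdeal S) ^ 2) :
    ∃ ν : ℕ, 2 ≤ ν ∧ f ∈ maximalIdeal S ^ ν ∧ f ∉ maximalIdeal S ^ (ν + 1) ∧ iotaOrd S f = ν ∧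
      ((∃ π : S, π ∈ maximalIdeal S ∧ π ∉ maximalIdeal S ^ 2 ∧ Associated f (π ^ ν)) ∨
        ∃ (x y : S) (b : ℕ), Ideal.span {x, y} = maximalIdeal S ∧ 1 ≤ b ∧
          ((b = 1 ∧ ¬ ∃ x' y' c : S, Ideal.span {x', y'} = maximalIdeal S ∧ IsUnit c ∧
              f - c * y' ^ ν ∈ weightedMonomialIdeal ![x', y'] ![1, 1] (1 * ν + 1)) ∨
           ((∃ c : S, IsUnit c ∧ f - c * y ^ ν ∈ weightedMonomialIdeal ![x, y] ![1, b] (b * ν + 1)) ∧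
              f ∉ weightedMonomialIdeal ![x, y] ![1, b + 1] ((b + 1) * ν)) ∨
           (2 ≤ b ∧ f ∈ weightedMonomialIdeal ![x, y] ![1, b] (b * ν) ∧
              ¬ ∃ c lam : S, IsUnit c ∧
                f - c * (y - lam * x ^ b) ^ ν ∈ weightedMonomialIdeal ![x, y] ![1, b] (b * ν + 1)))) := by
  classical
  haveI := isDomain_of_isRegularLocalRing S
  obtain ⟨ν, hν2, hfν, hfν', hιν⟩ := exists_order hf0 hf2
  refine ⟨ν, hν2, hfν, hfν', hιν, ?_⟩
  have hν1 : 1 ≤ ν := by omega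
  have hdimS : ringKrullDim S = (2 : ℕ) := ringKrullDim_eq_two_nat hdim
  by_contra H
  obtain ⟨HA, HT⟩ := not_or.mp H
  -- not prepared at level one in any coordinates: certificate (B) in any regular system of parameters
  by_cases hprep1 : ∃ x' y' c : S, Ideal.span {x', y'} = maximalIdeal S ∧ IsUnit c ∧
      f - c * y' ^ ν ∈ weightedMonomialIdeal ![x', y'] ![1, 1] (1 * ν + 1)
  swap
  · obtain ⟨x₀, y₀, hxy₀⟩ := exists_span_pair_eq_maximalIdeal S hdim
    exact HT ⟨x₀, y₀, 1, hxy₀, le_rfl, Or.inl ⟨rfl, hprep1⟩⟩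
  obtain ⟨x, y₁, c₁, hxy, hc₁, hprep₁⟩ := hprep1
  -- the loop: prepared at level `b` in `(x, y)` ⇒ prepared at level `b + 1` ((C) and (D) are excluded by `HT`)
  have hx : x ∈ maximalIdeal S := hxy ▸ Ideal.subset_span (by simp)
  set P : ℕ → S → Prop := fun b y => 1 ≤ b ∧ Ideal.span {x, y} = maximalIdeal S ∧
    ∃ c : S, IsUnit c ∧ f - c * y ^ ν ∈ weightedMonomialIdeal ![x, y] ![1, b] (b * ν + 1) with hPdef
  have hP : ∀ b y, P b y → y ∈ maximalIdeal S ∧ y ∉ maximalIdeal S ^ 2 ∧ f ∈ Ideal.span {y ^ ν, x ^ b} := by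
    rintro b y ⟨-, hxy', c, -, hprep⟩
    exact ⟨hxy' ▸ Ideal.subset_span (by simp), (LocalGameEFTSteepening.not_mem_sq_of_span_pair_eq hdimS hxy').2,
      LocalGameEFTNewton.mem_span_pair_of_prepared hprep⟩
  have hnext : ∀ b y, P b y → ∃ b' y', b < b' ∧ P b' y' ∧ y' - y ∈ Ideal.span {x ^ b} := by
    rintro b y ⟨hb, hxy', c, hc, hprep⟩
    rcases LocalGameEFTNewton.caseC_or_levelUp hc hprep with ⟨-, hc', hnot⟩ | hup
    · exact absurd ⟨x, y, b, hxy', hb, Or.inr (Or.inl ⟨hc', hnot⟩)⟩ HT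
    by_cases hst : ∃ c' lam : S, IsUnit c' ∧
        f - c' * (y - lam * x ^ (b + 1)) ^ ν ∈ weightedMonomialIdeal ![x, y] ![1, b + 1] ((b + 1) * ν + 1)
    swap
    · exact absurd ⟨x, y, b + 1, hxy', Nat.le_succ_of_le hb, Or.inr (Or.inr ⟨Nat.succ_le_succ hb, hup, hst⟩)⟩ HT
    obtain ⟨c', lam, hc', hprep'⟩ := hst
    refine ⟨b + 1, y - lam * x ^ (b + 1), Nat.lt_succ_self b, ⟨Nat.le_succ_of_le hb, ?_, c', hc', ?_⟩, ?_⟩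
    · rw [LocalGameEFTSteepening.span_pair_steepen_eq x y lam (Nat.succ_le_succ (Nat.zero_le b)), hxy']
    · rwa [LocalGameEFTSteepening.weightedMonomialIdeal_steepen_eq]
    · exact Ideal.span_singleton_le_span_singleton.mpr (pow_dvd_pow x (Nat.le_succ b))
        (LocalGameEFTSteepening.steepen_sub_mem x y lam _)
  have h₀ : P 1 y₁ := ⟨le_rfl, hxy, c₁, hc₁, hprep₁⟩
  -- excellence: an endless run of steepenings forces `f = unit · π^ν`
  have hk : IsExcellentRing k₀ := Stacks07QW_field_holds k₀ k₀ inferInstance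
  have hS : IsExcellentRing S := hk.of_essFiniteType ‹_›
  obtain ⟨π, hπ, hπ2, hass⟩ :=
    LocalGameEFTNewton.exists_associated_pow_of_forall_exists_next hS hx hν1 hfν' P hP hnext h₀
  exact HA ⟨π, hπ, hπ2, hass⟩

/-- **The point-move certificate at positions NOT of monomial type** (the (o24-G) case split): if `f` is not a unit
times the `ν`-th power of a regular parameter (`ν = ord_𝔪 f`), a terminal `(x, y_T, b_T)` with certificate
(B)/(C)/(D) exists, and the point move `(x, y_T), (1, b_T)` drops `iotaOrd` below `ν` at every singular successor
point. [OURS · L1 W4.3 · K7] -/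
theorem exists_terminal_of_not_associated_pow (S : Type) [CommRing S] [IsRegularLocalRing S]
    (k₀ : Type) [Field k₀] [Algebra k₀ S] [Algebra.EssFiniteType k₀ S]
    (hdim : ringKrullDim S = 2) (f : S) (hf0 : f ≠ 0) (hf2 : f ∈ (maximalIdeal S) ^ 2)
    (hnm : ¬ ∃ (v π : S) (ν : ℕ), IsUnit v ∧ π ∈ maximalIdeal S ∧ π ∉ maximalIdeal S ^ 2 ∧ f = v * π ^ ν) :
    ∃ ν : ℕ, 2 ≤ ν ∧ f ∈ maximalIdeal S ^ ν ∧ f ∉ maximalIdeal S ^ (ν + 1) ∧ iotaOrd S f = ν ∧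
      ∃ (x y : S) (b : ℕ), Ideal.span {x, y} = maximalIdeal S ∧ 1 ≤ b ∧
        (((b = 1 ∧ ¬ ∃ x' y' c : S, Ideal.span {x', y'} = maximalIdeal S ∧ IsUnit c ∧
              f - c * y' ^ ν ∈ weightedMonomialIdeal ![x', y'] ![1, 1] (1 * ν + 1)) ∨
           ((∃ c : S, IsUnit c ∧ f - c * y ^ ν ∈ weightedMonomialIdeal ![x, y] ![1, b] (b * ν + 1)) ∧
              f ∉ weightedMonomialIdeal ![x, y] ![1, b + 1] ((b + 1) * ν)) ∨
           (2 ≤ b ∧ f ∈ weightedMonomialIdeal ![x, y] ![1, b] (b * ν) ∧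
              ¬ ∃ c lam : S, IsUnit c ∧
                f - c * (y - lam * x ^ b) ^ ν ∈ weightedMonomialIdeal ![x, y] ![1, b] (b * ν + 1))) ∧
          ∀ (𝔫 : Ideal (extReesAlgebra (weightedMonomialIdeal ![x, y] ![1, b]))) [𝔫.IsPrime],
            extReesAlgebra.tInv (weightedMonomialIdeal ![x, y] ![1, b]) ∈ 𝔫 →
            (maximalIdeal S).map (algebraMap S (extReesAlgebra (weightedMonomialIdeal ![x, y] ![1, b]))) ≤ 𝔫 →
            ¬ (extReesAlgebra.vertexIdeal (weightedMonomialIdeal ![x, y] ![1, b]) ≤ 𝔫) →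
            ∀ (a' : ℕ) (g : extReesAlgebra (weightedMonomialIdeal ![x, y] ![1, b])),
              algebraMap S (extReesAlgebra (weightedMonomialIdeal ![x, y] ![1, b])) f =
                extReesAlgebra.tInv (weightedMonomialIdeal ![x, y] ![1, b]) ^ a' * g →
              ¬ (extReesAlgebra.tInv (weightedMonomialIdeal ![x, y] ![1, b]) ∣ g) →
              algebraMap (extReesAlgebra (weightedMonomialIdeal ![x, y] ![1, b])) (Localization.AtPrime 𝔫) g ∈
                (maximalIdeal (Localization.AtPrime 𝔫)) ^ 2 →
              iotaOrd (Localization.AtPrime 𝔫)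
                (algebraMap (extReesAlgebra (weightedMonomialIdeal ![x, y] ![1, b])) (Localization.AtPrime 𝔫) g) <
                ν) := by
  have hd : (maximalIdeal S).spanFinrank = 2 := spanFinrank_eq_two hdim
  obtain ⟨ν, hν2, hfν, hfν', hιν, hA | ⟨x, y, b, hxy, hb, hcert⟩⟩ :=
    exists_associated_pow_or_terminal S k₀ hdim f hf0 hf2
  · exfalso
    obtain ⟨π, hπ, hπ2, u, hu⟩ := hA
    exact hnm ⟨↑u⁻¹, π, ν, Units.isUnit _, hπ, hπ2, by rw [← hu, mul_comm f, Units.inv_mul_cancel_left]⟩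
  refine ⟨ν, hν2, hfν, hfν', hιν, x, y, b, hxy, hb, hcert, ?_⟩
  rcases hcert with ⟨rfl, hnp⟩ | ⟨⟨c, hc, hprep⟩, hnot⟩ | ⟨hb2, hfJ, hst⟩
  · exact (tangent_win_or_prepared hd hxy (by omega) hfν hfν').resolve_right hnp
  · exact pointMove_iotaOrd_lt_of_prepared_of_not_mem hd hxy hb hc hprep hnot
  · exact pointMove_iotaOrd_lt_of_not_steepenable hd hxy (by omega) hfν hfν' hb2 hfJ hst

end LocalGameEFTDimTwo

end Summit.ResolutionOfSingularities.ResolutionOfSingularities.Theorems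

end
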